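import Mathlib
import HarnessLib
import Summits.NavierStokesRegularity.NavierStokesRegularity.Theorems.SymmetryModuliCountForcedSymmetryRecurrentClosingResidual
import Summits.NavierStokesRegularity.NavierStokesRegularity.Theorems.SymmetryModuliCountForcedSymmetryClassEquivalence

/-!
# Crux `ForcedSymmetry` (stmt-NavierStokesRegularity-4052), line `recurrent-closing`: NO SLACK —
# `X ↔ (RecurrentClosingWeak ∧ RDSSLiouvilleInClass)`

Route `SymmetryModuliCount`, sub-problem `NavierStokesRegularity`.  Lead seat c3 (2026-08-17), skeleton gen 4.

The certificate that the line's two research stubs are each implied by the route target and jointly equivalent to it: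
`X → RecurrentClosingWeak` and `X → RDSSLiouvilleInClass` hold VACUOUSLY (under `X ↔ NoTypeIRateProfile`,
`typeIAncientLiouville_iff_noTypeIRateProfile`, no profile of the class is singular at the origin), and
`RecurrentClosingWeak ∧ RDSSLiouvilleInClass → X` is the residual `typeIAncientLiouville_of_recurrentClosingWeak`.  Unlike the
dead gen-1 lines, the residual is a CONJUNCTION of two statements with disjoint refutation targets (census §2), not one stub.

* `recurrentClosingWeak_of_typeIAncientLiouville`, `rdssLiouvilleInClass_of_typeIAncientLiouville`;
* `typeIAncientLiouville_iff_recurrentClosingWeak_and_rdssLiouville` (registered name), `forcedSymmetry_iff_recurrentClosingWeak_and_rdssLiouville`.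
-/

noncomputable section

-- the summit and its single problem share the name (D-0017 nested layout)
set_option linter.dupNamespace false

open MeasureTheory Set Function
open Literature.Analysis.FluidPDE
open Summit.NavierStokesRegularity.NavierStokesRegularity.Theses
open Summit.NavierStokesRegularity.NavierStokesRegularity.Theses.SymmetryModuliCount
open Summit.NavierStokesRegularity.NavierStokesRegularity.Theses.DulacContraction

namespace Summit.NavierStokesRegularity.NavierStokesRegularity.Theorems.SymmetryModuliCountForcedSymmetry

/-- **`X → RecurrentClosingWeak`** (vacuously): under `X` no profile of Albritton–Barker's class is singular at the origin
(`noTypeIRateProfile_of_typeIAncientLiouville`), so the hypotheses of the closing stub are never met. [cite: AlbrittonBarker2019, Thm 1.1, §3] -/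
theorem recurrentClosingWeak_of_typeIAncientLiouville (hX : TypeIAncientLiouville) :
    ∀ (u : ℝ → EuclideanSpace ℝ (Fin 3) → EuclideanSpace ℝ (Fin 3)) (p : ℝ → EuclideanSpace ℝ (Fin 3) → ℝ)
      (G : ℝ → EuclideanSpace ℝ (Fin 3) → EuclideanSpace ℝ (Fin 3) →L[ℝ] EuclideanSpace ℝ (Fin 3)) (C : ℝ),
      IsSuitableWeakSolutionOn (slab (EuclideanSpace ℝ (Fin 3)) (Set.Iio 0) isOpen_Iio) 1 0 u p →
      HasWeakSpatialGradientOn (slab (EuclideanSpace ℝ (Fin 3)) (Set.Iio 0) isOpen_Iio) u G →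
      typeIBound (Set.Iio (0 : ℝ) ×ˢ Set.univ) u p G < ⊤ →
      HasTypeITimeDecay C u →
      (∀ ε : ℝ, 0 < ε → ∀ K : Set (ℝ × EuclideanSpace ℝ (Fin 3)), IsCompact K → K ⊆ Set.Iic (0 : ℝ) ×ˢ Set.univ →
        ∃ L : ℝ, 0 < L ∧ ∀ a : ℝ, ∃ σ ∈ Set.Icc a (a + L),
          eLpNorm (fun z : ℝ × EuclideanSpace ℝ (Fin 3) => nsRescale (Real.exp σ) u z.1 z.2 - u z.1 z.2) 3
            (volume.restrict K) ≤ ENNReal.ofReal ε) →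
      IsBackwardSingularPoint u 0 →
      ∃ (w : ℝ → EuclideanSpace ℝ (Fin 3) → EuclideanSpace ℝ (Fin 3)) (q : ℝ → EuclideanSpace ℝ (Fin 3) → ℝ)
        (H : ℝ → EuclideanSpace ℝ (Fin 3) → EuclideanSpace ℝ (Fin 3) →L[ℝ] EuclideanSpace ℝ (Fin 3)) (C' : ℝ),
        IsSuitableWeakSolutionOn (slab (EuclideanSpace ℝ (Fin 3)) (Set.Iio 0) isOpen_Iio) 1 0 w q ∧
        HasWeakSpatialGradientOn (slab (EuclideanSpace ℝ (Fin 3)) (Set.Iio 0) isOpen_Iio) w H ∧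
        typeIBound (Set.Iio (0 : ℝ) ×ˢ Set.univ) w q H < ⊤ ∧
        HasTypeITimeDecay C' w ∧
        (∃ l : ℝ, 1 < l ∧ ∃ (R : EuclideanSpace ℝ (Fin 3) ≃ₗᵢ[ℝ] EuclideanSpace ℝ (Fin 3))
            (ξ : EuclideanSpace ℝ (Fin 3)) (τ : ℝ), τ ≤ 0 ∧
            (fun z : ℝ × EuclideanSpace ℝ (Fin 3) => l • R.symm (w (l ^ 2 * z.1 + τ) (l • R z.2 + ξ)))
              =ᵐ[volume.restrict (Set.Iio (0 : ℝ) ×ˢ Set.univ)]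
            (fun z : ℝ × EuclideanSpace ℝ (Fin 3) => w z.1 z.2)) ∧
        IsBackwardSingularPoint w 0 := by
  intro u p G C hsw hwg hI hdec _hrec hsing
  exact absurd hsing (noTypeIRateProfile_of_typeIAncientLiouville hX u p G C hsw hwg hI hdec)

/-- **`X → RDSSLiouvilleInClass`** (stmt-4050 ⇒ stmt-8561): under `X` no profile of the class is singular at the origin, in
particular no RDSS one. [cite: AlbrittonBarker2019, Thm 1.1, §3] -/
theorem rdssLiouvilleInClass_of_typeIAncientLiouville (hX : TypeIAncientLiouville) : RDSSLiouvilleInClass := by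
  intro w q H C hsw hwg hI hdec _hcl _hinv
  exact noTypeIRateProfile_of_typeIAncientLiouville hX w q H C hsw hwg hI hdec

/-- **NO SLACK: `X ↔ (RecurrentClosingWeak ∧ RDSSLiouvilleInClass)`** (registered name) — the route target is exactly the
conjunction of the line's two research stubs (each implied by `X`, jointly implying `X` through the landed bridge and
`recurrentReduction_proof`). [cite: AlbrittonBarker2019, Thm 1.1, §3; census §2/§D5] -/
theorem typeIAncientLiouville_iff_recurrentClosingWeak_and_rdssLiouville :
    TypeIAncientLiouville ↔
      ((∀ (u : ℝ → EuclideanSpace ℝ (Fin 3) → EuclideanSpace ℝ (Fin 3)) (p : ℝ → EuclideanSpace ℝ (Fin 3) → ℝ)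
          (G : ℝ → EuclideanSpace ℝ (Fin 3) → EuclideanSpace ℝ (Fin 3) →L[ℝ] EuclideanSpace ℝ (Fin 3)) (C : ℝ),
          IsSuitableWeakSolutionOn (slab (EuclideanSpace ℝ (Fin 3)) (Set.Iio 0) isOpen_Iio) 1 0 u p →
          HasWeakSpatialGradientOn (slab (EuclideanSpace ℝ (Fin 3)) (Set.Iio 0) isOpen_Iio) u G →
          typeIBound (Set.Iio (0 : ℝ) ×ˢ Set.univ) u p G < ⊤ →
          HasTypeITimeDecay C u →
          (∀ ε : ℝ, 0 < ε → ∀ K : Set (ℝ × EuclideanSpace ℝ (Fin 3)), IsCompact K → K ⊆ Set.Iic (0 : ℝ) ×ˢ Set.univ →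
            ∃ L : ℝ, 0 < L ∧ ∀ a : ℝ, ∃ σ ∈ Set.Icc a (a + L),
              eLpNorm (fun z : ℝ × EuclideanSpace ℝ (Fin 3) => nsRescale (Real.exp σ) u z.1 z.2 - u z.1 z.2) 3
                (volume.restrict K) ≤ ENNReal.ofReal ε) →
          IsBackwardSingularPoint u 0 →
          ∃ (w : ℝ → EuclideanSpace ℝ (Fin 3) → EuclideanSpace ℝ (Fin 3)) (q : ℝ → EuclideanSpace ℝ (Fin 3) → ℝ)
            (H : ℝ → EuclideanSpace ℝ (Fin 3) → EuclideanSpace ℝ (Fin 3) →L[ℝ] EuclideanSpace ℝ (Fin 3)) (C' : ℝ),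
            IsSuitableWeakSolutionOn (slab (EuclideanSpace ℝ (Fin 3)) (Set.Iio 0) isOpen_Iio) 1 0 w q ∧
            HasWeakSpatialGradientOn (slab (EuclideanSpace ℝ (Fin 3)) (Set.Iio 0) isOpen_Iio) w H ∧
            typeIBound (Set.Iio (0 : ℝ) ×ˢ Set.univ) w q H < ⊤ ∧
            HasTypeITimeDecay C' w ∧
            (∃ l : ℝ, 1 < l ∧ ∃ (R : EuclideanSpace ℝ (Fin 3) ≃ₗᵢ[ℝ] EuclideanSpace ℝ (Fin 3))
                (ξ : EuclideanSpace ℝ (Fin 3)) (τ : ℝ), τ ≤ 0 ∧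
                (fun z : ℝ × EuclideanSpace ℝ (Fin 3) => l • R.symm (w (l ^ 2 * z.1 + τ) (l • R z.2 + ξ)))
                  =ᵐ[volume.restrict (Set.Iio (0 : ℝ) ×ˢ Set.univ)]
                (fun z : ℝ × EuclideanSpace ℝ (Fin 3) => w z.1 z.2)) ∧
            IsBackwardSingularPoint w 0) ∧ RDSSLiouvilleInClass) :=
  ⟨fun hX => ⟨recurrentClosingWeak_of_typeIAncientLiouville hX, rdssLiouvilleInClass_of_typeIAncientLiouville hX⟩,
    fun h => typeIAncientLiouville_of_recurrentClosingWeak h.1 h.2⟩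

/-- **The crux ↔ the conjunction of the line's two research stubs.** [cite: AlbrittonBarker2019, Thm 1.1, §3; census §D5] -/
theorem forcedSymmetry_iff_recurrentClosingWeak_and_rdssLiouville :
    ForcedSymmetry ↔
      ((∀ (u : ℝ → EuclideanSpace ℝ (Fin 3) → EuclideanSpace ℝ (Fin 3)) (p : ℝ → EuclideanSpace ℝ (Fin 3) → ℝ)
          (G : ℝ → EuclideanSpace ℝ (Fin 3) → EuclideanSpace ℝ (Fin 3) →L[ℝ] EuclideanSpace ℝ (Fin 3)) (C : ℝ),
          IsSuitableWeakSolutionOn (slab (EuclideanSpace ℝ (Fin 3)) (Set.Iio 0) isOpen_Iio) 1 0 u p →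
          HasWeakSpatialGradientOn (slab (EuclideanSpace ℝ (Fin 3)) (Set.Iio 0) isOpen_Iio) u G →
          typeIBound (Set.Iio (0 : ℝ) ×ˢ Set.univ) u p G < ⊤ →
          HasTypeITimeDecay C u →
          (∀ ε : ℝ, 0 < ε → ∀ K : Set (ℝ × EuclideanSpace ℝ (Fin 3)), IsCompact K → K ⊆ Set.Iic (0 : ℝ) ×ˢ Set.univ →
            ∃ L : ℝ, 0 < L ∧ ∀ a : ℝ, ∃ σ ∈ Set.Icc a (a + L),
              eLpNorm (fun z : ℝ × EuclideanSpace ℝ (Fin 3) => nsRescale (Real.exp σ) u z.1 z.2 - u z.1 z.2) 3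
                (volume.restrict K) ≤ ENNReal.ofReal ε) →
          IsBackwardSingularPoint u 0 →
          ∃ (w : ℝ → EuclideanSpace ℝ (Fin 3) → EuclideanSpace ℝ (Fin 3)) (q : ℝ → EuclideanSpace ℝ (Fin 3) → ℝ)
            (H : ℝ → EuclideanSpace ℝ (Fin 3) → EuclideanSpace ℝ (Fin 3) →L[ℝ] EuclideanSpace ℝ (Fin 3)) (C' : ℝ),
            IsSuitableWeakSolutionOn (slab (EuclideanSpace ℝ (Fin 3)) (Set.Iio 0) isOpen_Iio) 1 0 w q ∧
            HasWeakSpatialGradientOn (slab (EuclideanSpace ℝ (Fin 3)) (Set.Iio 0) isOpen_Iio) w H ∧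
            typeIBound (Set.Iio (0 : ℝ) ×ˢ Set.univ) w q H < ⊤ ∧
            HasTypeITimeDecay C' w ∧
            (∃ l : ℝ, 1 < l ∧ ∃ (R : EuclideanSpace ℝ (Fin 3) ≃ₗᵢ[ℝ] EuclideanSpace ℝ (Fin 3))
                (ξ : EuclideanSpace ℝ (Fin 3)) (τ : ℝ), τ ≤ 0 ∧
                (fun z : ℝ × EuclideanSpace ℝ (Fin 3) => l • R.symm (w (l ^ 2 * z.1 + τ) (l • R z.2 + ξ)))
                  =ᵐ[volume.restrict (Set.Iio (0 : ℝ) ×ˢ Set.univ)]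
                (fun z : ℝ × EuclideanSpace ℝ (Fin 3) => w z.1 z.2)) ∧
            IsBackwardSingularPoint w 0) ∧ RDSSLiouvilleInClass) :=
  forcedSymmetry_iff_typeIAncientLiouville.trans typeIAncientLiouville_iff_recurrentClosingWeak_and_rdssLiouville

end Summit.NavierStokesRegularity.NavierStokesRegularity.Theorems.SymmetryModuliCountForcedSymmetry

end
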